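import Mathlib.FieldTheory.Finite.GaloisField
import Mathlib.GroupTheory.SpecificGroups.Cyclic
import Mathlib.Data.ZMod.Basic
import Mathlib.Tactic
import HarnessLib

/-!
# Route `AdditiveKolyvaginRoad`: ARITHMETIC OF THE DEPTH-ZERO TYPE SLOT — first lemma of crux card `division-type-slot`
# (crux KS′ `LevelKolyvaginSystemsAdditive`, item stmt-BirchSwinnertonDyer-21396; MODULE card, crux-ideate round 1 seat 2 g19)
# (cell `pub/bsd-wall`, width seat `bsd-wall-akr-p2x-w4` g6; `--supports stmt-BirchSwinnertonDyer-21396`, helper)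

THEOREMS ONLY (no definition, no named fact, no `sorry`); Mathlib-only content.  BSD is not proved by any of this; KS′ and KPA′
stay OPEN at `p² ∣ N`; nothing about deformation rings, types or quaternion algebras is asserted here.

THE POINT.  The crux-ideation card `Cruxes/LevelKolyvaginSystemsAdditive/Ideas/division-type-slot.md` (with its typed sketch
`Cruxes/LevelKolyvaginSystemsAdditive/RamifiedHabitatKuriharaSlotSketch.lean` §3) isolates, for the SUPERCUSPIDAL cells of the
residual (additive potentially good `p ≥ 5`, semistability defect `e ∈ {3, 4, 6}` with `e ∤ p − 1`), the elementary arithmetic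
of the depth-zero slot on the division algebra: the order-`e` character `θ = γ^{(p²−1)/e}` of `𝔽_{p²}ˣ = ⟨γ⟩`
(i) exists (`e ∣ p + 1 ∣ p² − 1`), (ii) is trivial on `𝔽_pˣ =` the `(p+1)`-th powers (`θ^{p+1} = 1`), (iii) is REGULAR
(`θ^p ≠ θ`, i.e. `θ^{p−1} ≠ 1`), and (iv) the level group `O_D^× ⧸ (1 + Π O_D) ≅ 𝔽_{p²}ˣ` is a `p′`-group (so the
`θ`-idempotent is `p`-integral).  The sketch states this as the `Prop` `DivisionTypeSlot.SlotArithmetic` (pure `ℕ`-arithmetic) and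
proves the instances `(p, e) = (5, 3), (7, 4)` by `decide`.  This file PROVES:

* `slotArithmetic` — the sketch's `SlotArithmetic` VERBATIM (the Cruxes sketch is not importable from `Theorems/`, so the `Prop`
  is unfolded; a skeleton on the card closes it by `exact slotArithmetic`):
  `∀ p e, p.Prime → 5 ≤ p → (e = 3 ∨ e = 4 ∨ e = 6) → ¬ e ∣ p - 1 → e ∣ p + 1 ∧ e ∣ p ^ 2 - 1 ∧
   (p ^ 2 - 1) ∣ (p + 1) * ((p ^ 2 - 1) / e) ∧ ¬ (p ^ 2 - 1) ∣ (p - 1) * ((p ^ 2 - 1) / e) ∧ Nat.Coprime p (p ^ 2 - 1)`;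
* `orderOf_slot_eq` / `slot_pow_add_one` / `slot_pow_sub_one_ne_one` — the same facts for an element `γ` of order `p² − 1` in ANY
  group (the character `θ` of the cyclic group `⟨γ⟩` being recorded, by duality, as the element `γ^{(p²−1)/e}`): `θ` has order
  `e`, `θ^{p+1} = 1`, `θ^{p−1} ≠ 1`;
* `slot_galoisField` — the literal `𝔽_{p²}` form: `#𝔽_{p²}ˣ = p² − 1` (as `Nat.card`) is prime to `p` (and is a unit mod `p`), and for a
  generator `γ` of the cyclic group `𝔽_{p²}ˣ` the element `θ = γ^{(p²−1)/e}` has order `e`, `θ^{p+1} = 1`, `θ^{p−1} ≠ 1`.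

Elementary (the card grades it «S-sized»); the `M`-sized typed statement behind it («free `τ`-cut carrier», Savitt 2005 Thm 6.22
+ patching) is NOT touched.  References: the card and sketch above. [folklore]
-/

-- D-0017: single-problem summit, so `Summit.BirchSwinnertonDyer.BirchSwinnertonDyer.…` repeats a namespace BY DESIGN.
set_option linter.dupNamespace false
set_option autoImplicit false

namespace Summit.BirchSwinnertonDyer.BirchSwinnertonDyer.Theorems.AdditiveKoly.DivisionTypeSlot

/-! ## §1 The `ℕ`-arithmetic -/

/-- For a prime `p ≥ 5` and `e ∈ {3, 4, 6}`: if `e ∤ p − 1` then `e ∣ p + 1` (`p` is odd and prime to `3`, so `p ≡ −1`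
modulo `3`, `4`, resp. `6`). [folklore] -/
theorem dvd_add_one_of_not_dvd_sub_one {p e : ℕ} (hp : p.Prime) (h5 : 5 ≤ p) (he : e = 3 ∨ e = 4 ∨ e = 6)
    (hnd : ¬ e ∣ p - 1) : e ∣ p + 1 := by
  have h2 : ¬ 2 ∣ p := fun h ↦ by
    rcases hp.eq_one_or_self_of_dvd 2 h with h | h <;> omega
  have h3 : ¬ 3 ∣ p := fun h ↦ by
    rcases hp.eq_one_or_self_of_dvd 3 h with h | h <;> omega
  have h2' : p % 2 = 1 := by omega
  have h3' : p % 3 = 1 ∨ p % 3 = 2 := by omega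
  -- `p ≡ 1 (mod 3)` would give `3 ∣ p - 1`, hence `e ∣ p - 1` for `e = 3, 6` (with `p` odd); so `p ≡ 2 (mod 3)`
  rcases he with rfl | rfl | rfl
  · rcases h3' with h | h
    · exact absurd (show 3 ∣ p - 1 by omega) hnd
    · omega
  · omega
  · rcases h3' with h | h
    · exact absurd (show 6 ∣ p - 1 by omega) hnd
    · omega

/-- `p² − 1 = (p − 1)(p + 1)` in `ℕ` for `p ≥ 1`. [folklore] -/
theorem sq_sub_one_eq {p : ℕ} (hp : 1 ≤ p) : p ^ 2 - 1 = (p - 1) * (p + 1) := by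
  have h1 : 1 ≤ p ^ 2 := Nat.one_le_pow _ _ hp
  zify [hp, h1]
  ring

/-- A prime `p` is coprime to `p² − 1`. [folklore] -/
theorem coprime_sq_sub_one {p : ℕ} (hp : p.Prime) : Nat.Coprime p (p ^ 2 - 1) := by
  refine hp.coprime_iff_not_dvd.mpr fun h ↦ ?_
  have h1 : 1 ≤ p ^ 2 := Nat.one_le_pow _ _ hp.pos
  have hp2 : p ∣ p ^ 2 := dvd_pow_self p two_ne_zero
  have h' : p ∣ p ^ 2 - (p ^ 2 - 1) := Nat.dvd_sub hp2 h
  rw [show p ^ 2 - (p ^ 2 - 1) = 1 by omega] at h'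
  exact hp.one_lt.ne' (Nat.eq_one_of_dvd_one h')

/-- **FIRST LEMMA of crux card `division-type-slot` (tree form of `DivisionTypeSlot.SlotArithmetic`, VERBATIM).**  For a prime
`p ≥ 5` and `e ∈ {3, 4, 6}` with `e ∤ p − 1` (the supercuspidal cells): `e ∣ p + 1`, `e ∣ p² − 1`,
`(p² − 1) ∣ (p + 1) · ((p² − 1)/e)` (the order-`e` character `θ = γ^{(p²−1)/e}` of `⟨γ⟩ = 𝔽_{p²}ˣ` kills the `(p+1)`-th powers
`= 𝔽_pˣ`), `(p² − 1) ∤ (p − 1) · ((p² − 1)/e)` (`θ^{p−1} ≠ 1`: `θ` is regular), and `p` is coprime to `p² − 1` (the level group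
is a `p′`-group).  Proof: write `p + 1 = e m`; then `(p² − 1)/e = (p − 1) m`, `(p + 1)(p − 1) m = (p² − 1) m`, and
`(p² − 1) ∣ (p − 1)² m` would force `e m = p + 1 ∣ (p − 1) m`, i.e. `e ∣ p − 1`. [folklore] -/
theorem slotArithmetic :
    ∀ p e : ℕ, p.Prime → 5 ≤ p → (e = 3 ∨ e = 4 ∨ e = 6) → ¬ e ∣ p - 1 →
      e ∣ p + 1 ∧ e ∣ p ^ 2 - 1 ∧
      (p ^ 2 - 1) ∣ (p + 1) * ((p ^ 2 - 1) / e) ∧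
      ¬ (p ^ 2 - 1) ∣ (p - 1) * ((p ^ 2 - 1) / e) ∧
      Nat.Coprime p (p ^ 2 - 1) := by
  intro p e hp h5 he hnd
  have he0 : 0 < e := by rcases he with rfl | rfl | rfl <;> norm_num
  have he1 : e ∣ p + 1 := dvd_add_one_of_not_dvd_sub_one hp h5 he hnd
  obtain ⟨m, hm⟩ := he1
  have hm0 : 0 < m := by
    rcases Nat.eq_zero_or_pos m with rfl | h
    · omega
    · exact h
  have hsq : p ^ 2 - 1 = (p - 1) * (p + 1) := sq_sub_one_eq hp.one_le
  have hq : (p ^ 2 - 1) / e = (p - 1) * m := by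
    rw [hsq, hm, show (p - 1) * (e * m) = e * ((p - 1) * m) by ring]
    exact Nat.mul_div_cancel_left _ he0
  refine ⟨⟨m, hm⟩, ?_, ?_, ?_, coprime_sq_sub_one hp⟩
  · rw [hsq, hm]
    exact Dvd.intro ((p - 1) * m) (by ring)
  · rw [hq, hsq, hm]
    exact Dvd.intro m (by ring)
  · rw [hq, hsq]
    intro hdvd
    apply hnd
    have hp1 : 0 < p - 1 := by omega
    have h1 : (p + 1) ∣ (p - 1) * m := by
      have : (p - 1) * (p + 1) ∣ (p - 1) * ((p - 1) * m) := by
        simpa [mul_assoc] using hdvd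
      exact (Nat.mul_dvd_mul_iff_left hp1).mp this
    rw [hm] at h1
    have h2 : e * m ∣ (p - 1) * m := h1
    exact (Nat.mul_dvd_mul_iff_right hm0).mp h2

/-! ## §2 The character `θ = γ^{(p²−1)/e}` of a cyclic group `⟨γ⟩` of order `p² − 1`, as an element -/

section Group

variable {G : Type*} [Group G]

/-- For `γ` of order `p² − 1` (`p ≥ 5` prime, `e ∈ {3,4,6}`, `e ∤ p − 1`), the element `θ = γ^{(p²−1)/e}` has order EXACTLY `e`.
[folklore] -/
theorem orderOf_slot_eq {p e : ℕ} (hp : p.Prime) (h5 : 5 ≤ p) (he : e = 3 ∨ e = 4 ∨ e = 6) (hnd : ¬ e ∣ p - 1)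
    (γ : G) (hγ : orderOf γ = p ^ 2 - 1) : orderOf (γ ^ ((p ^ 2 - 1) / e)) = e := by
  obtain ⟨-, he2, -⟩ := slotArithmetic p e hp h5 he hnd
  have hN0 : p ^ 2 - 1 ≠ 0 := by
    have : 25 ≤ p ^ 2 := by nlinarith
    omega
  have hk0 : (p ^ 2 - 1) / e ≠ 0 := by
    obtain ⟨c, hc⟩ := he2
    have he0 : 0 < e := by rcases he with rfl | rfl | rfl <;> norm_num
    rw [hc, Nat.mul_div_cancel_left _ he0]
    rintro rfl
    exact hN0 (by simpa using hc)
  rw [orderOf_pow_of_dvd hk0 (by rw [hγ]; exact Nat.div_dvd_of_dvd he2), hγ, Nat.div_div_self he2 hN0]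

/-- … `θ^{p+1} = 1`: `θ` is trivial on the `(p+1)`-th powers of `⟨γ⟩` (in `𝔽_{p²}ˣ`: on `𝔽_pˣ`). [folklore] -/
theorem slot_pow_add_one {p e : ℕ} (hp : p.Prime) (h5 : 5 ≤ p) (he : e = 3 ∨ e = 4 ∨ e = 6) (hnd : ¬ e ∣ p - 1)
    (γ : G) (hγ : orderOf γ = p ^ 2 - 1) : (γ ^ ((p ^ 2 - 1) / e)) ^ (p + 1) = 1 := by
  rw [← orderOf_dvd_iff_pow_eq_one, orderOf_slot_eq hp h5 he hnd γ hγ]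
  exact (slotArithmetic p e hp h5 he hnd).1

/-- … `θ^{p−1} ≠ 1`: `θ` is REGULAR (`θ^p ≠ θ`; on `𝔽_{p²}ˣ`: not fixed by Frobenius, so `Ind θ̃` is supercuspidal and `τ_θ` a
cuspidal type). [folklore] -/
theorem slot_pow_sub_one_ne_one {p e : ℕ} (hp : p.Prime) (h5 : 5 ≤ p) (he : e = 3 ∨ e = 4 ∨ e = 6) (hnd : ¬ e ∣ p - 1)
    (γ : G) (hγ : orderOf γ = p ^ 2 - 1) : (γ ^ ((p ^ 2 - 1) / e)) ^ (p - 1) ≠ 1 := by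
  rw [Ne, ← orderOf_dvd_iff_pow_eq_one, orderOf_slot_eq hp h5 he hnd γ hγ]
  exact hnd

/-- … and `θ^p ≠ θ` (the regularity in its usual form). [folklore] -/
theorem slot_pow_ne_self {p e : ℕ} (hp : p.Prime) (h5 : 5 ≤ p) (he : e = 3 ∨ e = 4 ∨ e = 6) (hnd : ¬ e ∣ p - 1)
    (γ : G) (hγ : orderOf γ = p ^ 2 - 1) : (γ ^ ((p ^ 2 - 1) / e)) ^ p ≠ γ ^ ((p ^ 2 - 1) / e) := by
  intro h
  apply slot_pow_sub_one_ne_one hp h5 he hnd γ hγ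
  rw [← pow_sub_one_mul (show p ≠ 0 from hp.ne_zero) (γ ^ ((p ^ 2 - 1) / e))] at h
  exact mul_right_cancel (h.trans (one_mul _).symm)

end Group

/-! ## §3 The literal `𝔽_{p²}` form -/

/-- **The slot on `𝔽_{p²}ˣ`.**  For a prime `p ≥ 5` and `e ∈ {3,4,6}` with `e ∤ p − 1`: `#𝔽_{p²}ˣ = p² − 1` is prime to `p`
(the level group `O_Dˣ ⧸ (1 + Π O_D) ≅ 𝔽_{p²}ˣ` is a `p′`-group; `p² − 1` is a unit mod `p`), `𝔽_{p²}ˣ` has a generator `γ`,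
and for EVERY generator `γ` the element `θ = γ^{(p²−1)/e}` has order `e`, satisfies `θ^{p+1} = 1` (trivial on
`𝔽_pˣ = (𝔽_{p²}ˣ)^{p+1}`) and `θ^{p−1} ≠ 1` (regular). [folklore] -/
theorem slot_galoisField (p e : ℕ) [hp : Fact p.Prime] (h5 : 5 ≤ p) (he : e = 3 ∨ e = 4 ∨ e = 6) (hnd : ¬ e ∣ p - 1) :
    Nat.card (GaloisField p 2)ˣ = p ^ 2 - 1 ∧
    Nat.Coprime p (Nat.card (GaloisField p 2)ˣ) ∧
    IsUnit ((Nat.card (GaloisField p 2)ˣ : ℕ) : ZMod p) ∧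
    (∃ γ : (GaloisField p 2)ˣ, orderOf γ = p ^ 2 - 1) ∧
    ∀ γ : (GaloisField p 2)ˣ, orderOf γ = p ^ 2 - 1 →
      orderOf (γ ^ ((p ^ 2 - 1) / e)) = e ∧ (γ ^ ((p ^ 2 - 1) / e)) ^ (p + 1) = 1 ∧
        (γ ^ ((p ^ 2 - 1) / e)) ^ (p - 1) ≠ 1 := by
  have hcard : Nat.card (GaloisField p 2)ˣ = p ^ 2 - 1 := by
    rw [Nat.card_units, GaloisField.card p 2 two_ne_zero]
  have hcop : Nat.Coprime p (p ^ 2 - 1) := coprime_sq_sub_one hp.out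
  refine ⟨hcard, hcard ▸ hcop, ?_, ?_, fun γ hγ ↦ ⟨orderOf_slot_eq hp.out h5 he hnd γ hγ,
    slot_pow_add_one hp.out h5 he hnd γ hγ, slot_pow_sub_one_ne_one hp.out h5 he hnd γ hγ⟩⟩
  · rw [hcard, ZMod.isUnit_iff_coprime]
    exact hcop.symm
  · obtain ⟨γ, hγ⟩ := IsCyclic.exists_ofOrder_eq_natCard (α := (GaloisField p 2)ˣ)
    exact ⟨γ, by rw [hγ, hcard]⟩

end Summit.BirchSwinnertonDyer.BirchSwinnertonDyer.Theorems.AdditiveKoly.DivisionTypeSlot
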